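import Summits.Ventures.PercRepro.GenQFlatFacts
import Summits.Ventures.PercRepro.GenQCoreChain

/-!
# PercRepro — the pencil through a flat: the flats one rank up partition the rest of `G` (night-4, gen 7)

Two distinct rank-`(r+1)` flats containing a rank-`r` flat `P` meet exactly in `P`, so their traces on `G` beyond
`P` are disjoint: the rank-`(r+1)` flats through `P` that meet `G` outside `P` number at most `|G ∖ P|`
(`card_flats_through_le`).  This is the «pencil» count behind the cap `h_s ≤ 2(|G| − s)` on big hyperplane traces
and the solid–plane incidence row of sheet §62 (k4)/(k10).  Imports `GenQFlatFacts`.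
-/
namespace PercRepro.Night4

open Finset ThmH SixFour GenQ PerFlat Star

variable {α : Type} [DecidableEq α] {M : Matroid α} [M.Finite]

omit [DecidableEq α] [M.Finite] in
/-- The intersection of two flats is a flat (from `Matroid.IsFlat.iInter` over `Bool`). -/
theorem isFlat_inter_of_isFlat {F F' : Set α} (hF : M.IsFlat F) (hF' : M.IsFlat F') : M.IsFlat (F ∩ F') := by
  have h := Matroid.IsFlat.iInter (M := M) (Fs := fun b : Bool => if b then F else F')
    (fun b => by cases b <;> simpa)
  convert h using 1
  ext x
  simp only [Set.mem_inter_iff, Set.mem_iInter, Bool.forall_bool, Bool.false_eq_true, if_false, if_true]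
  exact and_comm

/-- Two distinct rank-`(r+1)` flats through a rank-`r` flat `P` meet exactly in `P`. -/
theorem inter_eq_of_flatsQ_succ {r : ℕ} {P F F' : Finset α} (hP : P ∈ flatsQ M r) (hF : F ∈ flatsQ M (r + 1))
    (hF' : F' ∈ flatsQ M (r + 1)) (hPF : P ⊆ F) (hPF' : P ⊆ F') (hne : F ≠ F') : F ∩ F' = P := by
  have hP' := mem_flatsQ.1 hP
  have hF1 := mem_flatsQ.1 hF
  have hF1' := mem_flatsQ.1 hF'
  -- `F ∩ F'` is a flat with `P ⊆ F ∩ F' ⊆ F`; its rank is `r` or `r + 1`; `r + 1` would force `F = F ∩ F' = F'`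
  have hflat : M.IsFlat ((F ∩ F' : Finset α) : Set α) := by
    rw [Finset.coe_inter]
    exact isFlat_inter_of_isFlat hF1.2.1 hF1'.2.1
  have hsub : P ⊆ F ∩ F' := Finset.subset_inter hPF hPF'
  have hle : M.eRk ((F ∩ F' : Finset α) : Set α) ≤ ((r + 1 : ℕ) : ℕ∞) := by
    rw [← hF1.2.2]
    exact M.eRk_mono (Finset.coe_subset.2 Finset.inter_subset_left)
  have hge : (r : ℕ∞) ≤ M.eRk ((F ∩ F' : Finset α) : Set α) := by
    rw [← hP'.2.2]
    exact M.eRk_mono (Finset.coe_subset.2 hsub)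
  obtain ⟨a, ha⟩ := exists_eRk_eq_nat (M := M) (F ∩ F')
  rw [ha] at hle hge
  have h1 : a ≤ r + 1 := by exact_mod_cast hle
  have h2 : r ≤ a := by exact_mod_cast hge
  rcases Nat.eq_or_lt_of_le h2 with h | h
  · -- rank `r`: `F ∩ F'` is a flat of rank `r` containing the rank-`r` flat `P`, hence equal to `P`
    apply Finset.Subset.antisymm _ hsub
    have hcl : M.closure (P : Set α) = M.closure ((F ∩ F' : Finset α) : Set α) :=
      (M.isRkFinite_of_finite (Finset.finite_toSet P)).closure_eq_closure_of_subset_of_eRk_ge_eRk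
        (Finset.coe_subset.2 hsub) (by rw [ha, hP'.2.2, ← h])
    rw [hP'.2.1.closure, hflat.closure] at hcl
    intro x hx
    exact Finset.mem_coe.1 (hcl ▸ Finset.mem_coe.2 hx)
  · -- rank `r + 1`: then `F ∩ F' = F` and `= F'`, contradicting `F ≠ F'`
    exfalso
    have ha' : a = r + 1 := by omega
    have hclF : M.closure ((F ∩ F' : Finset α) : Set α) = M.closure (F : Set α) :=
      (M.isRkFinite_of_finite (Finset.finite_toSet (F ∩ F'))).closure_eq_closure_of_subset_of_eRk_ge_eRk
        (Finset.coe_subset.2 Finset.inter_subset_left) (by rw [ha, hF1.2.2, ha'])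
    have hclF' : M.closure ((F ∩ F' : Finset α) : Set α) = M.closure (F' : Set α) :=
      (M.isRkFinite_of_finite (Finset.finite_toSet (F ∩ F'))).closure_eq_closure_of_subset_of_eRk_ge_eRk
        (Finset.coe_subset.2 Finset.inter_subset_right) (by rw [ha, hF1'.2.2, ha'])
    rw [hF1.2.1.closure] at hclF
    rw [hF1'.2.1.closure] at hclF'
    exact hne (Finset.coe_injective (hclF.symm.trans hclF'))

/-- **The pencil count.** The rank-`(r+1)` flats through a rank-`r` flat `P` that meet `G` outside `P` number at most
`|G ∖ P|`: their traces beyond `P` are disjoint and non-empty. -/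
theorem card_flats_through_le {r : ℕ} {P G : Finset α} (hP : P ∈ flatsQ M r) :
    ((flatsQ M (r + 1)).filter (fun F => P ⊆ F ∧ ((F \ P) ∩ G).Nonempty)).card ≤ (G \ P).card := by
  classical
  set S := (flatsQ M (r + 1)).filter (fun F => P ⊆ F ∧ ((F \ P) ∩ G).Nonempty) with hS
  -- the shares `(F ∖ P) ∩ G` are pairwise disjoint subsets of `G ∖ P`
  have hdisj : (S : Set (Finset α)).PairwiseDisjoint (fun F => (F \ P) ∩ G) := by
    intro F hF F' hF' hne
    rw [Finset.mem_coe, hS, Finset.mem_filter] at hF hF'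
    rw [Function.onFun, Finset.disjoint_left]
    intro x hx hx'
    rw [Finset.mem_inter, Finset.mem_sdiff] at hx hx'
    have : x ∈ F ∩ F' := Finset.mem_inter.2 ⟨hx.1.1, hx'.1.1⟩
    rw [inter_eq_of_flatsQ_succ hP hF.1 hF'.1 hF.2.1 hF'.2.1 hne] at this
    exact hx.1.2 this
  calc S.card = ∑ F ∈ S, 1 := by simp
    _ ≤ ∑ F ∈ S, ((F \ P) ∩ G).card := by
        refine Finset.sum_le_sum (fun F hF => ?_)
        rw [hS, Finset.mem_filter] at hF
        exact Finset.card_pos.2 hF.2.2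
    _ = (S.biUnion (fun F => (F \ P) ∩ G)).card := (Finset.card_biUnion hdisj).symm
    _ ≤ (G \ P).card := by
        refine Finset.card_le_card ?_
        intro x hx
        rw [Finset.mem_biUnion] at hx
        obtain ⟨F, _, hxF⟩ := hx
        rw [Finset.mem_inter, Finset.mem_sdiff] at hxF
        exact Finset.mem_sdiff.2 ⟨hxF.2, hxF.1.2⟩

/-- Two distinct rank-`(r+1)` flats meet in a flat of rank `≤ r`: the intersection has at most `f r` points on the core
(`card_le_fCore_of_core`) — the cap (P0) of the hyperplane block: `2s − |G| > fCore r` forbids two `s`-point traces. -/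
theorem card_inter_le_fCore_of_core {p : ℕ} (hc : NightThree.Core M p) (h10 : ∀ F ∈ flatsQ M 4, F.card ≤ 10)
    {r : ℕ} {F F' : Finset α} (hF : F ∈ flatsQ M (r + 1)) (hF' : F' ∈ flatsQ M (r + 1)) (hne : F ≠ F') :
    (F ∩ F').card ≤ fCore r := by
  have hF1 := mem_flatsQ.1 hF
  have hF1' := mem_flatsQ.1 hF'
  have hflat : M.IsFlat ((F ∩ F' : Finset α) : Set α) := by
    rw [Finset.coe_inter]
    exact isFlat_inter_of_isFlat hF1.2.1 hF1'.2.1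
  -- the rank of `F ∩ F'` is at most `r`: rank `r + 1` would force `F = F ∩ F' = F'`
  obtain ⟨a, ha⟩ := exists_eRk_eq_nat (M := M) (F ∩ F')
  have hle : (a : ℕ∞) ≤ ((r + 1 : ℕ) : ℕ∞) := by
    rw [← ha, ← hF1.2.2]
    exact M.eRk_mono (Finset.coe_subset.2 Finset.inter_subset_left)
  have h1 : a ≤ r + 1 := by exact_mod_cast hle
  have har : a ≤ r := by
    by_contra h
    have ha' : a = r + 1 := by omega
    have hclF : M.closure ((F ∩ F' : Finset α) : Set α) = M.closure (F : Set α) :=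
      (M.isRkFinite_of_finite (Finset.finite_toSet (F ∩ F'))).closure_eq_closure_of_subset_of_eRk_ge_eRk
        (Finset.coe_subset.2 Finset.inter_subset_left) (by rw [ha, hF1.2.2, ha'])
    have hclF' : M.closure ((F ∩ F' : Finset α) : Set α) = M.closure (F' : Set α) :=
      (M.isRkFinite_of_finite (Finset.finite_toSet (F ∩ F'))).closure_eq_closure_of_subset_of_eRk_ge_eRk
        (Finset.coe_subset.2 Finset.inter_subset_right) (by rw [ha, hF1'.2.2, ha'])
    rw [hF1.2.1.closure] at hclF
    rw [hF1'.2.1.closure] at hclF'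
    exact hne (Finset.coe_injective (hclF.symm.trans hclF'))
  -- `F ∩ F'` is a rank-`a` flat, `a ≤ r`: `≤ fCore a ≤ fCore r` points
  have hmem : F ∩ F' ∈ flatsQ M a := by
    rw [mem_flatsQ]
    exact ⟨Finset.inter_subset_left.trans hF1.1, hflat, ha⟩
  exact (card_le_fCore_of_core hc h10 a (F ∩ F') hmem).trans (fCore_mono har)

/-- A flat of rank `≤ r` on the core has `≤ fCore r` points (`card_le_fCore_of_core` + monotonicity), stated for a flat
given with its exact rank `a ≤ r`. -/
theorem card_le_fCore_of_flat_rank_le {p : ℕ} (hc : NightThree.Core M p) (h10 : ∀ F ∈ flatsQ M 4, F.card ≤ 10)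
    {F : Finset α} {a r : ℕ} (hF : F ∈ flatsQ M a) (har : a ≤ r) : F.card ≤ fCore r :=
  (card_le_fCore_of_core hc h10 a F hF).trans (fCore_mono har)

/-- The intersection of two finsets is a flat of `M` with a rank: `F ∩ F' ∈ flatsQ M a` for the right `a`. -/
theorem inter_mem_flatsQ {r r' : ℕ} {F F' : Finset α} (hF : F ∈ flatsQ M r) (hF' : F' ∈ flatsQ M r') :
    ∃ a, F ∩ F' ∈ flatsQ M a ∧ a ≤ r := by
  have hF1 := mem_flatsQ.1 hF
  have hF1' := mem_flatsQ.1 hF'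
  obtain ⟨a, ha⟩ := exists_eRk_eq_nat (M := M) (F ∩ F')
  refine ⟨a, ?_, ?_⟩
  · rw [mem_flatsQ]
    refine ⟨Finset.inter_subset_left.trans hF1.1, ?_, ha⟩
    rw [Finset.coe_inter]
    exact isFlat_inter_of_isFlat hF1.2.1 hF1'.2.1
  · have hle : (a : ℕ∞) ≤ (r : ℕ∞) := by
      rw [← ha, ← hF1.2.2]
      exact M.eRk_mono (Finset.coe_subset.2 Finset.inter_subset_left)
    exact_mod_cast hle

/-- The intersection of two DISTINCT rank-`(r+1)` flats is a flat of rank `a ≤ r`. -/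
theorem inter_mem_flatsQ_of_ne {r : ℕ} {F F' : Finset α} (hF : F ∈ flatsQ M (r + 1)) (hF' : F' ∈ flatsQ M (r + 1))
    (hne : F ≠ F') : ∃ a, F ∩ F' ∈ flatsQ M a ∧ a ≤ r := by
  obtain ⟨a, hK, har⟩ := inter_mem_flatsQ hF hF'
  refine ⟨a, hK, ?_⟩
  by_contra h
  have ha' : a = r + 1 := by omega
  have hF1 := mem_flatsQ.1 hF
  have hF1' := mem_flatsQ.1 hF'
  have hK' := mem_flatsQ.1 hK
  have hclF : M.closure ((F ∩ F' : Finset α) : Set α) = M.closure (F : Set α) :=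
    (M.isRkFinite_of_finite (Finset.finite_toSet (F ∩ F'))).closure_eq_closure_of_subset_of_eRk_ge_eRk
      (Finset.coe_subset.2 Finset.inter_subset_left) (by rw [hK'.2.2, hF1.2.2, ha'])
  have hclF' : M.closure ((F ∩ F' : Finset α) : Set α) = M.closure (F' : Set α) :=
    (M.isRkFinite_of_finite (Finset.finite_toSet (F ∩ F'))).closure_eq_closure_of_subset_of_eRk_ge_eRk
      (Finset.coe_subset.2 Finset.inter_subset_right) (by rw [hK'.2.2, hF1'.2.2, ha'])
  rw [hF1.2.1.closure] at hclF
  rw [hF1'.2.1.closure] at hclF'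
  exact hne (Finset.coe_injective (hclF.symm.trans hclF'))

omit [DecidableEq α] in
/-- Two flats of the same rank, one inside the other, are equal. -/
theorem eq_of_subset_of_flatsQ {a : ℕ} {K L : Finset α} (hK : K ∈ flatsQ M a) (hL : L ∈ flatsQ M a) (hLK : L ⊆ K) :
    L = K := by
  have hK' := mem_flatsQ.1 hK
  have hL' := mem_flatsQ.1 hL
  apply Finset.coe_injective
  have h1 : M.closure (L : Set α) = M.closure (K : Set α) :=
    (M.isRkFinite_of_finite (Finset.finite_toSet L)).closure_eq_closure_of_subset_of_eRk_ge_eRk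
      (Finset.coe_subset.2 hLK) (by rw [hK'.2.2, hL'.2.2])
  rw [hL'.2.1.closure, hK'.2.1.closure] at h1
  exact h1

/-- **The pencil clause (P1).** On the core, three distinct rank-`(r+1)` flats whose traces on `G` are so big that
`|F₁ ∩ G| + |F₂ ∩ G| + |F₃ ∩ G| − 2|G| > fCore (r − 1)` share the rank-`r` flat `F₁ ∩ F₂` (`r ≥ 1`): the triple
intersection has more points than any flat of rank `< r` can hold, so `F₁ ∩ F₂ ∩ F₃` has rank `r`, hence equals `F₁ ∩ F₂`. -/
theorem inter_subset_of_three_traces {p r : ℕ} (hc : NightThree.Core M p) (h10 : ∀ F ∈ flatsQ M 4, F.card ≤ 10)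
    (hr : 1 ≤ r) {G F₁ F₂ F₃ : Finset α} (h₁ : F₁ ∈ flatsQ M (r + 1)) (h₂ : F₂ ∈ flatsQ M (r + 1))
    (h₃ : F₃ ∈ flatsQ M (r + 1)) (hne : F₁ ≠ F₂)
    (hbig : fCore (r - 1) + 2 * G.card < (F₁ ∩ G).card + (F₂ ∩ G).card + (F₃ ∩ G).card) :
    F₁ ∩ F₂ ⊆ F₃ := by
  -- `K = F₁ ∩ F₂` has rank `a ≤ r`; `L = K ∩ F₃` has rank `b ≤ a`
  obtain ⟨a, hK, har⟩ := inter_mem_flatsQ_of_ne h₁ h₂ hne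
  obtain ⟨b, hL, hba⟩ := inter_mem_flatsQ hK h₃
  -- the triple trace: `|F₁ ∩ F₂ ∩ F₃ ∩ G| ≥ |F₁ ∩ G| + |F₂ ∩ G| + |F₃ ∩ G| − 2|G|`
  have hie : ∀ A B : Finset α, A ⊆ G → B ⊆ G → A.card + B.card ≤ (A ∩ B).card + G.card := by
    intro A B hA hB
    have h1 := Finset.card_union_add_card_inter A B
    have h2 : (A ∪ B).card ≤ G.card := Finset.card_le_card (Finset.union_subset hA hB)
    omega
  have hA12 := hie (F₁ ∩ G) (F₂ ∩ G) Finset.inter_subset_right Finset.inter_subset_right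
  have hA123 := hie (F₁ ∩ G ∩ (F₂ ∩ G)) (F₃ ∩ G) (Finset.inter_subset_right.trans Finset.inter_subset_right) Finset.inter_subset_right
  have heq : F₁ ∩ G ∩ (F₂ ∩ G) ∩ (F₃ ∩ G) = (F₁ ∩ F₂ ∩ F₃) ∩ G := by
    ext x; simp only [Finset.mem_inter]; tauto
  rw [heq] at hA123
  -- a flat of rank `b ≤ r − 1` cannot hold that many points
  have hbr : r ≤ b := by
    by_contra hlt
    have hle : ((F₁ ∩ F₂ ∩ F₃) ∩ G).card ≤ fCore (r - 1) :=
      (Finset.card_le_card Finset.inter_subset_left).trans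
        (card_le_fCore_of_flat_rank_le hc h10 hL (by omega))
    omega
  -- so `L` and `K` have the same rank `r` and `L ⊆ K` ⇒ `L = K` ⇒ `K ⊆ F₃`
  have hb : b = r := by omega
  have ha : a = r := by omega
  subst hb; subst ha
  have hLK : F₁ ∩ F₂ ∩ F₃ ⊆ F₁ ∩ F₂ := Finset.inter_subset_left
  have := eq_of_subset_of_flatsQ hK hL hLK
  rw [← this]
  exact Finset.inter_subset_right

end PercRepro.Night4
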